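import Summits.CriticalPhenomena.PercolationContinuityZ3.Theorems.PercNearOneGluingNoHeavyLowerTailSetPlainMarkerDominance
import Summits.CriticalPhenomena.PercolationContinuityZ3.Theorems.PercNearOneGluingNoHeavyLowerTailQ7PsiSetObserverHalf
import HarnessLib

/-!
# `NoHeavyLowerTail` (stmt-CriticalPhenomena-4575) — CLUB-Ψ: prim-lf-3's quantitative glued Question 9 from `P1**-PLAIN-set`

Support file (prover `prim-cplus-coupling`, gen 16; `--supports stmt-CriticalPhenomena-4575`); no definitions, named facts
or sorries.  Cell memo A5-COUPLING-gen16.md.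

One bond percolation `μ`, observer SET `N`, ports `x` (designated) and `y`, witness `z`; `v ↔ N := ∃ n ∈ N, v ↔ n`,
`C_N = ⋃_{n ∈ N} C_n`, `J' = ({x↔N} ∪ {y↔N}) ∩ {z↮N}`, `E = {x↮N} ∩ {y↮N} ∩ {z↮N}`, `W2 = {y↔N} ∩ {x↮N} ∩ {z↮N}`,
`E2 = {y↮x} ∩ {y↮z}`, `Dzx = {z↮x}`, `Mz = {z↔N} ∩ {z↮x}`, `Jyz = {z↔y} ∩ {z↮x}`; masses `b = μ(W2)`, `e₂ = μ(E2)`,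
`d = μ(Dzx)`, `c = μ(Mz)`, `j = μ(Jyz)`.  The CLUB functional of a monotone `F ≥ 0` on vertex sets is
`K_x(F) = ∫_{J'} [F(C_N) − F(C_z)] + ∫_E [F(C_x) − F(C_z)]`, and `Dx(F) = E F(C_x) − E F(C_z)`, `Dy(F) = E F(C_y) − E F(C_z)`.
* `ClubPsi.bhk_W2_event` — BHK Thm 1.3 given `{y ↮ x, z}`: `(∫_{E2} G(C_y)) · b ≤ e₂ · ∫_{W2} G(C_y)`.
* `ClubPsi.joint_nonneg` — the JOINT atom (denominator-free):
  `e₂ d ∫_{W2} G(C_y) − b d ∫_{y↮x} G(C_y) + e₂ d ∫_{Mz} G(C_z) − (e₂ c − b j) ∫_{Dzx} G(C_z) ≥ 0` for every monotone `G`,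
  = `d ·` [`P1**-PLAIN-set` for the owner `z`, avoided `x`, marker `y` (`ClubPsi.setPlainMarkerDominance_cov`)] `+ d ·` [`bhk_W2_event`].
* `ClubPsi.club_L_nonneg` — conditioning on `C_y` and on `C_z` (tower property `Q7Psi.setIntegral_cluster_tower`, Harris off the
  cluster `Q7Psi.setIntegral_offEvent_le`; the conditional mean `k_F(S) = E F(C_x(η ∖ S̄))` is ONE antitone function of the
  cluster `S`, whichever of `y, z` owns it) turns `joint_nonneg` at `G = F` and at `G = −k_F` into
  `e₂ d [∫_{W2} (F(C_y) − F(C_x)) + ∫_{Mz} (F(C_z) − F(C_x))] ≥ b d · (E F(C_y) − E F(C_x)) + (e₂ c − b j) · (E F(C_z) − E F(C_x))`.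
* `ClubPsi.club_certificate` — with the pointwise bound `K_x − Dx ≥ ∫_{W2}(F(C_y) − F(C_x)) + ∫_{Mz}(F(C_z) − F(C_x))`
  (`C_y ⊆ C_N` on `{y↔N}`, `C_x ⊆ C_N` on `{x↔N}`):  `(e₂ d − b d − e₂ c + b j) · Dx(F) + b d · Dy(F) ≤ e₂ d · K_x(F)`.
* `ClubPsi.club_kappa_nonneg` — `0 ≤ (e₂ d − b d − e₂ c + b j) · μ(x ↮ y, z)` (the certificate at `F = 1{y ∈ ·} ∨ 1{z ∈ ·}`).
* `ClubPsi.clubPsi` — **CLUB-Ψ(x)**: if `μ(x↮y,z), e₂, d > 0` (e.g. all weights `< 1`), then `Dx(F) ≥ 0` and `Dy(F) ≥ 0` imply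
  `K_x(F) ≥ 0`, i.e. `E F(Ĉ_x) ≥ E F(C̃_z)` in `G/N` (prim-lf-3 LF3-BETA-R §18g MRΨ-glued; at the green function = CLUB(c) of §18d,
  the last residual of the 2+m kernel).  For `N = {o}` this is the max-robust (GΨ₃) (`Q7Psi.gpsi_three_maxrobust`).
[cite: KozmaNitzan2024, §5.1 (pp. 31–32), Questions 7–9 (p. 36)] [cite: VandenbergHaggstromKahn2005, Thm 1.3 (p. 6), §1 pp. 7–8]
-/

namespace Summit.CriticalPhenomena.PercolationContinuityZ3.Theorems

open MeasureTheory Set Literature.Probability.LatticeModels Literature.Probability.Percolation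
open scoped Classical
open KNPreFKG BHK2006 DecisionTree LonePortSum LonePortSumGeneral

noncomputable section

namespace ClubPsi

open Q7Psi

universe u

variable {V : Type u} [Fintype V]

/-- **BHK Thm 1.3 given `{y ↮ x, z}` against the event `W2 = {y↔N} ∩ {x↮N} ∩ {z↮N}`**: for monotone `G`,
`(∫_{E2} G(C_y)) · μ(W2) ≤ μ(E2) · ∫_{W2} G(C_y)` with `E2 = {y↮x} ∩ {y↮z} ⊇ W2` — although `1_{W2}` is not monotone,
given `C_y` it is an increasing cluster event times a decreasing off-cluster event (`Q7Psi.setSep_offCluster_posCorrelation_event`,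
the pattern of `Q7Psi.hx_set_of_setMDL` with `x ↔ y`). [cite: VandenbergHaggstromKahn2005, Thm. 1.3 (p. 6) and pp. 7–8 — corollary] -/
theorem bhk_W2_event (w : Sym2 V → unitInterval) (x y z : V) (N : Set V) (hyx : y ≠ x) (hyz : y ≠ z)
    (G : Set V → ℝ) (hG : ∀ S T : Set V, S ⊆ T → G S ≤ G T) :
    (∫ ω in {ω : BondConfig V | ¬ (openGraph ω).Reachable y x} ∩ {ω | ¬ (openGraph ω).Reachable y z},
        G (openCluster ω y) ∂(prodBernoulli w)) *
      (prodBernoulli w).real ({ω : BondConfig V | ∃ n ∈ N, (openGraph ω).Reachable y n} ∩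
        ({ω | ∀ n ∈ N, ¬ (openGraph ω).Reachable x n} ∩ {ω | ∀ n ∈ N, ¬ (openGraph ω).Reachable z n})) ≤
    (prodBernoulli w).real ({ω : BondConfig V | ¬ (openGraph ω).Reachable y x} ∩ {ω | ¬ (openGraph ω).Reachable y z}) *
      ∫ ω in {ω : BondConfig V | ∃ n ∈ N, (openGraph ω).Reachable y n} ∩
        ({ω | ∀ n ∈ N, ¬ (openGraph ω).Reachable x n} ∩ {ω | ∀ n ∈ N, ¬ (openGraph ω).Reachable z n}),
        G (openCluster ω y) ∂(prodBernoulli w) := by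
  classical
  set μ := prodBernoulli w with hμ
  set f : BondConfig V → ℝ := fun ω => G (openCluster ω y) with hf
  set E2 : Set (BondConfig V) := {ω : BondConfig V | ¬ (openGraph ω).Reachable y x} ∩
    {ω | ¬ (openGraph ω).Reachable y z} with hE2def
  set Oy : Set (BondConfig V) := {ω : BondConfig V | ∃ n ∈ N, (openGraph ω).Reachable y n} with hOy
  set Ex : Set (BondConfig V) := {ω | ∀ n ∈ N, ¬ (openGraph ω).Reachable x n} with hEx
  set Ez : Set (BondConfig V) := {ω | ∀ n ∈ N, ¬ (openGraph ω).Reachable z n} with hEz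
  set W2 : Set (BondConfig V) := Oy ∩ (Ex ∩ Ez) with hW2
  show (∫ ω in E2, f ω ∂μ) * μ.real W2 ≤ μ.real E2 * ∫ ω in W2, f ω ∂μ
  have hyX : y ∉ ({x, z} : Set V) := by
    simp only [mem_insert_iff, mem_singleton_iff, not_or]; exact ⟨hyx, hyz⟩
  have hE2X : {ω : BondConfig V | ∀ v ∈ ({x, z} : Set V), ¬ (openGraph ω).Reachable y v} = E2 := by
    ext ω
    simp only [mem_insert_iff, mem_singleton_iff, forall_eq_or_imp, forall_eq, mem_setOf_eq, hE2def, mem_inter_iff]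
  set NN : Set (Sym2 V) → ℝ := fun C => if ∃ n ∈ N, (n = y ∨ ∃ e ∈ C, n ∈ e) then 1 else 0 with hNN
  have hNNmono : Monotone NN := by
    intro C C' hCC'
    simp only [hNN]
    by_cases h : ∃ n ∈ N, (n = y ∨ ∃ e ∈ C, n ∈ e)
    · have h' : ∃ n ∈ N, (n = y ∨ ∃ e ∈ C', n ∈ e) :=
        h.imp fun n ⟨hn, hc⟩ => ⟨hn, hc.imp id fun ⟨e, he, hne⟩ => ⟨e, hCC' he, hne⟩⟩
      rw [if_pos h, if_pos h']
    · rw [if_neg h]; split_ifs <;> norm_num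
  have hNN0 : ∀ C, 0 ≤ NN C := fun C => by simp only [hNN]; split_ifs <;> norm_num
  have hNNval : ∀ ω : BondConfig V, NN (openEdgeCluster ω y) = ind Oy ω := by
    intro ω
    by_cases hω : ω ∈ Oy
    · obtain ⟨n, hn, hr⟩ := hω
      rw [ind_of_mem (show ω ∈ Oy from ⟨n, hn, hr⟩), hNN]
      simp only
      rw [if_pos ⟨n, hn, (reachable_iff_exists_mem_openEdgeCluster ω y n).1 hr⟩]
    · rw [ind_of_not_mem hω, hNN]
      simp only
      rw [if_neg]
      rintro ⟨n, hn, hc⟩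
      exact hω ⟨n, hn, (reachable_iff_exists_mem_openEdgeCluster ω y n).2 hc⟩
  set Gf : BondConfig V → ℝ := ind (Ex ∩ Ez) with hGf
  have hExz : IsLowerSet (Ex ∩ Ez) := (isLowerSet_notReachSet x N).inter (isLowerSet_notReachSet z N)
  have hGa : Antitone Gf := fun ξ ξ' h => ind_anti_of_isLowerSet hExz h
  have hG0 : ∀ ξ, 0 ≤ Gf ξ := fun ξ => ind_nonneg _ _
  have hloc : ∀ ω : BondConfig V, (∀ v ∈ ({x, z} : Set V), ¬ (openGraph ω).Reachable y v) →
      Gf (ω \ {e | ∃ v ∈ e, v = y ∨ ∃ e' ∈ openEdgeCluster ω y, v ∈ e'}) = Gf ω := by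
    intro ω hω
    have hx' : ¬ (openGraph ω).Reachable y x := hω x (by simp)
    have hz' : ¬ (openGraph ω).Reachable y z := hω z (by simp)
    have key : (ω \ {e | ∃ v ∈ e, v = y ∨ ∃ e' ∈ openEdgeCluster ω y, v ∈ e'}) ∈ Ex ∩ Ez ↔ ω ∈ Ex ∩ Ez := by
      simp only [mem_inter_iff, hEx, hEz, mem_setOf_eq]
      exact and_congr (forall₂_congr fun n _ => not_congr (reachable_sdiff_bar_iff hx' n))
        (forall₂_congr fun n _ => not_congr (reachable_sdiff_bar_iff hz' n))
    simp only [hGf]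
    by_cases h : ω ∈ Ex ∩ Ez
    · rw [ind_of_mem h, ind_of_mem (key.2 h)]
    · rw [ind_of_not_mem h, ind_of_not_mem (fun h' => h (key.1 h'))]
  have hB0 := Q7Psi.setSep_offCluster_posCorrelation_event w y ({x, z} : Set V) hyX
    (fun C => G {a | a = y ∨ ∃ e ∈ C, a ∈ e}) (monotone_clusterFun y G hG) NN hNNmono hNN0 Gf hGa hG0 hloc
  simp only [hE2X, clusterFun_openEdgeCluster, hNNval] at hB0
  have hNG : ∀ ω : BondConfig V, ind Oy ω * Gf ω = ind W2 ω := by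
    intro ω
    simp only [hGf]
    by_cases h1 : ω ∈ Oy
    · by_cases h2 : ω ∈ Ex ∩ Ez
      · rw [ind_of_mem h1, ind_of_mem h2, ind_of_mem (show ω ∈ W2 from ⟨h1, h2⟩), one_mul]
      · rw [ind_of_not_mem h2, ind_of_not_mem (show ω ∉ W2 from fun h => h2 h.2), mul_zero]
    · rw [ind_of_not_mem h1, ind_of_not_mem (show ω ∉ W2 from fun h => h1 h.1), zero_mul]
  have hW2E2 : W2 ⊆ E2 := by
    rintro ω ⟨⟨n, hn, hyn⟩, hx', hz'⟩
    exact ⟨fun hyx' => hx' n hn (hyx'.symm.trans hyn), fun hyz' => hz' n hn (hyz'.symm.trans hyn)⟩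
  have hI1 : ∫ ω in E2, ind Oy ω * Gf ω ∂μ = μ.real W2 := by
    simp_rw [hNG]
    rw [setIntegral_eq_sum w E2]
    have : ∀ ω, ind W2 ω * ind E2 ω = ind W2 ω := fun ω => by
      rw [mul_comm]; exact ind_mul_ind_of_subset hW2E2 ω
    simp_rw [this]
    have h1 := setIntegral_eq_sum w W2 (fun _ => (1 : ℝ))
    simp only [one_mul] at h1
    rw [← h1, setIntegral_const, smul_eq_mul, mul_one]
  have hI2 : ∫ ω in E2, f ω * (ind Oy ω * Gf ω) ∂μ = ∫ ω in W2, f ω ∂μ := by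
    simp_rw [hNG]
    rw [setIntegral_eq_sum w E2, setIntegral_eq_sum w W2]
    refine Finset.sum_congr rfl fun ω _ => ?_
    have := ind_mul_ind_of_subset hW2E2 ω
    rw [show f ω * ind W2 ω * ind E2 ω = f ω * (ind E2 ω * ind W2 ω) by ring, this]
  rw [hI1, hI2] at hB0
  exact hB0

/-- **The JOINT atom** (denominator-free).  For every monotone `G` on vertex sets,
`e₂ d ∫_{W2} G(C_y) − b d ∫_{y↮x} G(C_y) + e₂ d ∫_{Mz} G(C_z) − (e₂ c − b j) ∫_{Dzx} G(C_z) ≥ 0`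
(notation of the file header).  Proof: `d ·` (`P1**-PLAIN-set` for owner `z`, avoided `x`, marker `y`) `+ d ·` (`bhk_W2_event`),
and `∫_{y↮x} G(C_y) = ∫_{E2} G(C_y) + ∫_{Jyz} G(C_z)` (`C_y = C_z` on `{y ↔ z}`). (cell memo A5-COUPLING-gen16 §2, KEY IDENTITY)
[cite: KozmaNitzan2024, Question 9 (p. 36)] [cite: VandenbergHaggstromKahn2005, Thms 1.3–1.5 (pp. 6–7), §2.1] -/
theorem joint_nonneg (w : Sym2 V → unitInterval) (x y z : V) (N : Set V) (hyx : y ≠ x) (hyz : y ≠ z)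
    (G : Set V → ℝ) (hG : ∀ S T : Set V, S ⊆ T → G S ≤ G T) :
    0 ≤ (prodBernoulli w).real ({ω : BondConfig V | ¬ (openGraph ω).Reachable y x} ∩ {ω | ¬ (openGraph ω).Reachable y z}) *
          (prodBernoulli w).real {ω : BondConfig V | ¬ (openGraph ω).Reachable z x} *
          (∫ ω in {ω : BondConfig V | ∃ n ∈ N, (openGraph ω).Reachable y n} ∩
              ({ω | ∀ n ∈ N, ¬ (openGraph ω).Reachable x n} ∩ {ω | ∀ n ∈ N, ¬ (openGraph ω).Reachable z n}),
              G (openCluster ω y) ∂(prodBernoulli w)) -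
        (prodBernoulli w).real ({ω : BondConfig V | ∃ n ∈ N, (openGraph ω).Reachable y n} ∩
              ({ω | ∀ n ∈ N, ¬ (openGraph ω).Reachable x n} ∩ {ω | ∀ n ∈ N, ¬ (openGraph ω).Reachable z n})) *
          (prodBernoulli w).real {ω : BondConfig V | ¬ (openGraph ω).Reachable z x} *
          (∫ ω in {ω : BondConfig V | ¬ (openGraph ω).Reachable y x}, G (openCluster ω y) ∂(prodBernoulli w)) +
        (prodBernoulli w).real ({ω : BondConfig V | ¬ (openGraph ω).Reachable y x} ∩ {ω | ¬ (openGraph ω).Reachable y z}) *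
          (prodBernoulli w).real {ω : BondConfig V | ¬ (openGraph ω).Reachable z x} *
          (∫ ω in {ω : BondConfig V | ∃ n ∈ N, (openGraph ω).Reachable z n} ∩ {ω | ¬ (openGraph ω).Reachable z x},
              G (openCluster ω z) ∂(prodBernoulli w)) -
        ((prodBernoulli w).real ({ω : BondConfig V | ¬ (openGraph ω).Reachable y x} ∩ {ω | ¬ (openGraph ω).Reachable y z}) *
            (prodBernoulli w).real ({ω : BondConfig V | ∃ n ∈ N, (openGraph ω).Reachable z n} ∩
              {ω | ¬ (openGraph ω).Reachable z x}) -
          (prodBernoulli w).real ({ω : BondConfig V | ∃ n ∈ N, (openGraph ω).Reachable y n} ∩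
              ({ω | ∀ n ∈ N, ¬ (openGraph ω).Reachable x n} ∩ {ω | ∀ n ∈ N, ¬ (openGraph ω).Reachable z n})) *
            (prodBernoulli w).real (openConn z y ∩ {ω | ¬ (openGraph ω).Reachable z x})) *
          (∫ ω in {ω : BondConfig V | ¬ (openGraph ω).Reachable z x}, G (openCluster ω z) ∂(prodBernoulli w)) := by
  classical
  set μ := prodBernoulli w with hμ
  set gy : BondConfig V → ℝ := fun ω => G (openCluster ω y) with hgy
  set gz : BondConfig V → ℝ := fun ω => G (openCluster ω z) with hgz
  set Oy : Set (BondConfig V) := {ω : BondConfig V | ∃ n ∈ N, (openGraph ω).Reachable y n} with hOy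
  set Oz : Set (BondConfig V) := {ω : BondConfig V | ∃ n ∈ N, (openGraph ω).Reachable z n} with hOz
  set Ex : Set (BondConfig V) := {ω | ∀ n ∈ N, ¬ (openGraph ω).Reachable x n} with hEx
  set Ez : Set (BondConfig V) := {ω | ∀ n ∈ N, ¬ (openGraph ω).Reachable z n} with hEz
  set W2 : Set (BondConfig V) := Oy ∩ (Ex ∩ Ez) with hW2
  set Dyx : Set (BondConfig V) := {ω : BondConfig V | ¬ (openGraph ω).Reachable y x} with hDyx
  set Dyz : Set (BondConfig V) := {ω : BondConfig V | ¬ (openGraph ω).Reachable y z} with hDyz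
  set Dzx : Set (BondConfig V) := {ω : BondConfig V | ¬ (openGraph ω).Reachable z x} with hDzx
  set E2 : Set (BondConfig V) := Dyx ∩ Dyz with hE2
  set Mz : Set (BondConfig V) := Oz ∩ Dzx with hMz
  set Jyz : Set (BondConfig V) := openConn z y ∩ Dzx with hJyz
  show 0 ≤ μ.real E2 * μ.real Dzx * (∫ ω in W2, gy ω ∂μ) - μ.real W2 * μ.real Dzx * (∫ ω in Dyx, gy ω ∂μ) +
      μ.real E2 * μ.real Dzx * (∫ ω in Mz, gz ω ∂μ) -
      (μ.real E2 * μ.real Mz - μ.real W2 * μ.real Jyz) * (∫ ω in Dzx, gz ω ∂μ)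
  -- PLAIN for the owner `z`, avoided `x`, marker `y`
  have hP := setPlainMarkerDominance_cov w z y x N hyz.symm G hG
  rw [show ({ω : BondConfig V | ∀ n ∈ N, ¬ (openGraph ω).Reachable z n} ∩ {ω | ∀ n ∈ N, ¬ (openGraph ω).Reachable x n}) =
      Ex ∩ Ez from Set.inter_comm _ _,
    show ({ω : BondConfig V | ¬ (openGraph ω).Reachable y z} ∩ {ω | ¬ (openGraph ω).Reachable y x}) = E2 from
      Set.inter_comm _ _] at hP
  change μ.real W2 * (μ.real Dzx * (∫ ω in Jyz, gz ω ∂μ) - μ.real Jyz * ∫ ω in Dzx, gz ω ∂μ) ≤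
    μ.real E2 * (μ.real Dzx * (∫ ω in Mz, gz ω ∂μ) - μ.real Mz * ∫ ω in Dzx, gz ω ∂μ) at hP
  -- BHK for the owner `y`
  have hB := bhk_W2_event w x y z N hyx hyz G hG
  change (∫ ω in E2, gy ω ∂μ) * μ.real W2 ≤ μ.real E2 * ∫ ω in W2, gy ω ∂μ at hB
  -- `∫_{y↮x} G(C_y) = ∫_{E2} G(C_y) + ∫_{Jyz} G(C_z)`
  have hsplit : ∫ ω in Dyx, gy ω ∂μ = (∫ ω in E2, gy ω ∂μ) + ∫ ω in Jyz, gz ω ∂μ := by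
    rw [setIntegral_eq_sum w Dyx, setIntegral_eq_sum w E2, setIntegral_eq_sum w Jyz, ← Finset.sum_add_distrib]
    refine Finset.sum_congr rfl fun ω _ => ?_
    rw [← mul_add]
    congr 1
    by_cases hyzr : (openGraph ω).Reachable y z
    · have hE : ω ∉ E2 := fun h => h.2 hyzr
      rw [ind_of_not_mem hE, mul_zero, zero_add]
      have hcl : openCluster ω y = openCluster ω z := openCluster_eq_of_reachable hyzr
      by_cases hx : ω ∈ Dyx
      · have hJ : ω ∈ Jyz := ⟨hyzr.symm, fun h => hx (hyzr.trans h)⟩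
        rw [ind_of_mem hx, ind_of_mem hJ]
        simp only [hgy, hgz, hcl]
      · have hJ : ω ∉ Jyz := fun h => hx fun h' => h.2 (hyzr.symm.trans h')
        rw [ind_of_not_mem hx, ind_of_not_mem hJ, mul_zero, mul_zero]
    · have hJ : ω ∉ Jyz := fun h => hyzr h.1.symm
      rw [ind_of_not_mem hJ, mul_zero, add_zero]
      by_cases hx : ω ∈ Dyx
      · rw [ind_of_mem hx, ind_of_mem (show ω ∈ E2 from ⟨hx, hyzr⟩)]
      · rw [ind_of_not_mem hx, ind_of_not_mem (show ω ∉ E2 from fun h => hx h.1)]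
  rw [hsplit]
  have hd0 : 0 ≤ μ.real Dzx := measureReal_nonneg
  have hB' := mul_le_mul_of_nonneg_left hB hd0
  nlinarith [hP, hB']

end ClubPsi

end

end Summit.CriticalPhenomena.PercolationContinuityZ3.Theorems
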